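import Summits.QuantumAdvantage.QuantumAdvantage.Theorems.CubicForrelationNearExactIsExactFourteenLevelSix
import Summits.QuantumAdvantage.QuantumAdvantage.Theorems.CubicForrelationNearExactIsExactFourteenTypeO
import Summits.QuantumAdvantage.QuantumAdvantage.Theorems.CubicForrelationNearExactIsExactThetaLadder
import Summits.QuantumAdvantage.QuantumAdvantage.Theorems.CubicForrelationNearExactIsExactLadderEnvelope

/-!
# Crux `CubicForrelation.NearExactIsExact` (stmt-QuantumAdvantage-14043) — n = 14: the boundary value `31/32` is NOT attained;
  `Φ ≥ 31/32 ⇒ Φ = 1` for cubic pairs on 14 bits, so `θ₁₄ ∈ [57/64, 31/32)`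

Certificate seat `b2b-cforr-cert` (gen 4).  HONEST FRAMING: a DECIDABLE VERDICT about the finite slice `n = 14` of the crux, obtained by
the first TWO-SIDED (partner-using) argument above the one-sided ladder — NOT summit progress (the crux needs one `θ < 1` for all `n`).

The tree had `θ₁₄ ∈ [57/64, 31/32]` (`theta_fourteen_bounds`: isolation above `31/32` by the one-sided 2-adic tower, `57/64` attained).
The tower's constant `31/32` is Parseval-consistent as a one-sided capacity, so whether `Φ = 31/32` occurs needs the partner `f`.
ASSEMBLY (`fb_isolation_fourteen_ge`): for cubic `f, g` on 14 bits with `Φ(f,g) ≥ 31/32`, write `W_g = 32 u_g`, `W_f = 32 u_f` (Ax);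
each parity `[u odd]` is constant (`fd_parity_const`).
* `g` at level 7 (`W_g ∈ 128ℤ`): bent ⇒ `Φ = 1` or `≤ 15/16` (Hou); non-bent ⇒ capacity `≤ 15/16` (`tw_top`).  ⇒ `Φ = 1`.
* `g` at level 6 with an odd quotient: impossible (`fl_levelSix_false`, two-sided).
* `g` of type O: then `f` at level 7 ⇒ `Φ = 1` (symmetry); `f` at level 6 ⇒ impossible (`fl_levelSix_false` for `(g,f)`); `f` of type O ⇒
  impossible (`ft_typeO_pair_false`, two-sided).
Hence `isolation_fourteen_closed` (at the literal type `Fin 14`), `theta_fourteen_lt` (some `θ < 31/32` isolates exactness on 14 bits —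
the largest non-exact value, by finiteness), and `theta_fourteen_halfopen`: the least isolation constant satisfies `57/64 ≤ θ₁₄ < 31/32`.

References: as in the imported files (Ax/McEliece, Hou 1998, MacWilliams–Sloane Ch. 13–15, Aaronson–Ambainis 2018 §1.1.1).  Everything
below is proved from Mathlib and the tree; axioms are the standard three; no `decide` beyond the imported ladder file.
-/

set_option linter.dupNamespace false -- D-0017: single-problem summit ⇒ `QuantumAdvantage.QuantumAdvantage` by design

noncomputable section

namespace Summit.QuantumAdvantage.QuantumAdvantage.Theorems.CubicForrelation.NearExactIsExact

open Finset
open Literature.Computability.QuantumComplexity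
open Literature.Computability.QuantumComplexity.DerivativeWalsh (W)
open Summit.QuantumAdvantage.QuantumAdvantage.Theorems.SignedCubicForrelationNotPrBPP.Negative.HalfQuad (forrelation_comm)

/-- **Level 7 at the boundary.** For cubic `f, g` on 14 bits with `W_g ∈ 128ℤ` and `Φ(f,g) ≥ 31/32`: `Φ(f,g) = 1` (bent ⇒ Hou + Reed–Muller
give `Φ = 1 ∨ Φ ≤ 15/16`; non-bent ⇒ the top tower level caps the capacity at `15/16`). [this work] -/
theorem fb_levelSeven (f g : (Fin (7 + 7) → Bool) → Bool) (hf : IsDegLeFun 3 f) (hg : IsDegLeFun 3 g)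
    (w : (Fin (7 + 7) → Bool) → ℤ) (hw : ∀ x, W (fun y => signOf (g y)) x = (2 : ℝ) ^ 7 * (w x : ℝ))
    (hΦ : (31 / 32 : ℝ) ≤ forrelation f g) : forrelation f g = 1 := by
  rcases tw_top (m := 7) (d := 3) g w hg hw (by intro k hk hkn; omega) with hbent | hcap
  · rcases tw_bent_end (by norm_num : 3 ≤ 7) f g hf hg hbent with h | h
    · exact h
    · exfalso; norm_num at h; linarith
  · exfalso
    have := tw_forrelation_le_of_cap f g hcap
    norm_num at this
    linarith

/-- **`Φ ≥ 31/32 ⇒ Φ = 1` for cubic pairs on `7 + 7` bits** (the assembly described in the header). [this work] -/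
theorem fb_isolation_fourteen_ge (f g : (Fin (7 + 7) → Bool) → Bool) (hf : IsDegLeFun 3 f) (hg : IsDegLeFun 3 g)
    (hΦ : (31 / 32 : ℝ) ≤ forrelation f g) : forrelation f g = 1 := by
  obtain ⟨ug, hug⟩ := tw_base g hg 5 (by norm_num)
  obtain ⟨uf, huf⟩ := tw_base f hf 5 (by norm_num)
  have hΦ' : (31 / 32 : ℝ) ≤ forrelation g f := by rw [forrelation_comm]; exact hΦ
  by_cases hog : ∀ x, Odd (ug x)
  · -- `g` of type O: split on `f`
    by_cases hof : ∀ x, Odd (uf x)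
    · exact (ft_typeO_pair_false f g hg ug hug uf huf hog hof hΦ).elim
    · push Not at hof
      obtain ⟨x₀, hx₀⟩ := hof
      have hfe : ∀ x, ¬ Odd (uf x) := fun x h => hx₀ ((fd_parity_const f uf hf huf x x₀).1 h)
      have huf' := tw_level_up f uf huf hfe
      by_cases hodd6 : ∃ x, Odd (uf x / 2)
      · exact (fl_levelSix_false g f hf (fun x => uf x / 2) huf' hodd6 hΦ').elim
      · push Not at hodd6
        have huf'' := tw_level_up f (fun x => uf x / 2) huf' hodd6
        rw [forrelation_comm]
        exact fb_levelSeven g f hg hf _ huf'' hΦ'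
  · push Not at hog
    obtain ⟨x₀, hx₀⟩ := hog
    have hge : ∀ x, ¬ Odd (ug x) := fun x h => hx₀ ((fd_parity_const g ug hg hug x x₀).1 h)
    have hug' := tw_level_up g ug hug hge
    by_cases hodd6 : ∃ x, Odd (ug x / 2)
    · exact (fl_levelSix_false f g hg (fun x => ug x / 2) hug' hodd6 hΦ).elim
    · push Not at hodd6
      have hug'' := tw_level_up g (fun x => ug x / 2) hug' hodd6
      exact fb_levelSeven f g hf hg _ hug'' hΦ

/-- **The boundary value `31/32` is not attained on 14 bits: `Φ(f,g) ≥ 31/32 ⇒ Φ(f,g) = 1` for all cubic `f, g : 𝔽₂¹⁴ → 𝔽₂`**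
(at the literal type `Fin 14`).  Improves `isolation_fourteen` (`>`) to `≥`; the improvement is two-sided (it uses the partner `f`).
Finite-slice verdict; NOT summit progress. [this work] -/
theorem isolation_fourteen_closed : ∀ f g : (Fin 14 → Bool) → Bool, IsDegLeFun 3 f → IsDegLeFun 3 g →
    (31 / 32 : ℝ) ≤ forrelation f g → forrelation f g = 1 :=
  fun f g hf hg h => fb_isolation_fourteen_ge f g hf hg h

/-- From a CLOSED isolation statement to a strictly smaller constant (general `n`): if `Φ ≥ c ⇒ Φ = 1` for cubic pairs on `n` bits,
then some `θ < c` already isolates exactness — the largest forrelation value `≠ 1` of a cubic pair on `n` bits (a maximum over a finite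
non-empty set), which is `< c`. [this work] -/
theorem fb_theta_lt_of_closed {n : ℕ} (c : ℝ)
    (hc : ∀ f g : (Fin n → Bool) → Bool, IsDegLeFun 3 f → IsDegLeFun 3 g → c ≤ forrelation f g → forrelation f g = 1) :
    ∃ θ : ℝ, θ < c ∧ ∀ f g : (Fin n → Bool) → Bool, IsDegLeFun 3 f → IsDegLeFun 3 g →
      θ < forrelation f g → forrelation f g = 1 := by
  classical
  set S : Finset (((Fin n → Bool) → Bool) × ((Fin n → Bool) → Bool)) :=
    univ.filter fun p => IsDegLeFun 3 p.1 ∧ IsDegLeFun 3 p.2 ∧ forrelation p.1 p.2 ≠ 1 with hS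
  have hne : S.Nonempty := by
    by_cases h0 : forrelation (fun _ : Fin n → Bool => false) (fun _ => false) = 1
    · refine ⟨((fun _ => false), (fun _ => true)), ?_⟩
      rw [hS, mem_filter]
      refine ⟨mem_univ _, isDegLeFun_const 3 false, isDegLeFun_const 3 true, ?_⟩
      have h : forrelation (fun _ : Fin n → Bool => false) (fun _ => true) =
          -forrelation (fun _ : Fin n → Bool => false) (fun _ => false) :=
        DerivativeWalsh.forrelation_not_right (fun _ : Fin n → Bool => false) (fun _ : Fin n → Bool => false)
      rw [h, h0]
      norm_num
    · refine ⟨((fun _ => false), (fun _ => false)), ?_⟩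
      rw [hS, mem_filter]
      exact ⟨mem_univ _, isDegLeFun_const 3 false, isDegLeFun_const 3 false, h0⟩
  obtain ⟨p₀, hp₀, hmax⟩ := S.exists_max_image (fun p => forrelation p.1 p.2) hne
  have hp : IsDegLeFun 3 p₀.1 ∧ IsDegLeFun 3 p₀.2 ∧ forrelation p₀.1 p₀.2 ≠ 1 := by
    rw [hS, mem_filter] at hp₀
    exact hp₀.2
  refine ⟨forrelation p₀.1 p₀.2, ?_, fun f g hf hg hlt => ?_⟩
  · by_contra hge
    push Not at hge
    exact hp.2.2 (hc p₀.1 p₀.2 hp.1 hp.2.1 hge)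
  · by_contra hne1
    have hmem : (f, g) ∈ S := by
      rw [hS, mem_filter]
      exact ⟨mem_univ _, hf, hg, hne1⟩
    exact absurd hlt (not_lt.2 (hmax (f, g) hmem))

/-- **`θ₁₄ < 31/32`: some constant strictly below `31/32` already isolates exactness for cubic pairs on 14 bits** — the largest
forrelation value `≠ 1` of a cubic pair on 14 bits, which is `< 31/32` by `isolation_fourteen_closed`.  Finite-slice verdict; NOT
summit progress. [this work] -/
theorem theta_fourteen_lt : ∃ θ : ℝ, θ < 31 / 32 ∧ ∀ f g : (Fin 14 → Bool) → Bool, IsDegLeFun 3 f → IsDegLeFun 3 g →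
    θ < forrelation f g → forrelation f g = 1 :=
  fb_theta_lt_of_closed (n := 14) (31 / 32) isolation_fourteen_closed

/-- **`θ₁₄ ∈ [57/64, 31/32)`** — the `n = 14` row of the ladder with a HALF-OPEN upper end: the least isolation constant `θ₁₄` for
cubic pairs on 14 bits exists, is at least `57/64` (attained by the product pair, `theta_fourteen_bounds`) and is STRICTLY below the
one-sided tower constant `31/32` (`theta_fourteen_lt`).  The window `(57/64, 31/32)` remains open.  Finite-slice verdict; NOT summit
progress. [this work] -/
theorem theta_fourteen_halfopen : ∃ θ₀ : ℝ, 57 / 64 ≤ θ₀ ∧ θ₀ < 31 / 32 ∧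
    IsLeast {θ : ℝ | ∀ f g : (Fin 14 → Bool) → Bool, IsDegLeFun 3 f → IsDegLeFun 3 g →
      θ < forrelation f g → forrelation f g = 1} θ₀ := by
  obtain ⟨θ₀, hθ₀⟩ := theta_exists 14
  obtain ⟨θ', hθ', hiso⟩ := theta_fourteen_lt
  exact ⟨θ₀, theta_fourteen_bounds.2 θ₀ hθ₀.1, lt_of_le_of_lt (hθ₀.2 hiso) hθ', hθ₀⟩

end Summit.QuantumAdvantage.QuantumAdvantage.Theorems.CubicForrelation.NearExactIsExact

end
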